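import Mathlib
import Literature.NumberTheory.LFunctions.WeilExplicit
import Literature.NumberTheory.LFunctions.WeilMellinBounds

/-!
# Stub `face_erase` (plan T5c, heredity in `S`) for crux `WeilComb.CombShapePositivity`
(item stmt-RiemannHypothesis-11229, route route-RiemannHypothesis-WeilComb, line `Sketch`,
stub-plan `Cruxes/CombShapePositivity/STUB-PLAN-stub_fejer.md`, tier T5c "heredity in S")

Notation: prime box `N_S = ∏_{p∈S} p^n`, Bohr character `χ_{S,θ}(d) = exp(i Σ_{p∈S} θ_p v_p(d))`,
Fejér face `face(S, θ) = Re Σ_{d,d' ∣ N_S} χ_{S,θ}(d) conj χ_{S,θ}(d') w(log d − log d')` for a kernel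
`w : ℝ → ℂ` (in the stub: the comb symbol `w_ε(x) = W(τ_x (φ_ε ⋆ φ̃_ε))`, `φ_ε` the route bump).

**Statement (T5c).** For `q ∈ S`: if `face(S, update θ q t₁) ≥ 0` for every angle `t₁`, then
`face(S.erase q, θ) ≥ 0`. So the Fejér faces of the registered stub `stub_fejer` are DOWNWARD
HEREDITARY in `S` (the failing set of `S` is an up-set).

**Proof** (for an ARBITRARY kernel `w`, `face_erase_kernel`; the stub is the specialisation to
`w_ε`). Put `L = n + 1` and average the hypothesis over the grid `t = 2πk/L`, `k < L`, in the
`q`-coordinate. Splitting `Σ_{p∈S}` into the `q`-term and `Σ_{p ∈ S.erase q}` (the update does not move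
`θ_p` for `p ≠ q`) gives `χ_{S, update θ q t}(d) = e^{i t v_q(d)} χ_{S∖q,θ}(d)` (`bohrChar_update`), so
`Σ_{k<L} face-sum(S, θ_k) = Σ_{d,d' ∣ N_S} [Σ_{k<L} e^{2πi k (v_q(d) − v_q(d'))/L}] χ'(d) conj χ'(d') w(log d − log d')`
with `χ' = χ_{S∖q,θ}`. The bracket is `L · [v_q(d) = v_q(d')]` (`orth_one`: both valuations lie in
`[0, n]`, so they are congruent mod `L` iff equal). The surviving pairs are `d = q^j e`, `d' = q^j e'`,
`j ≤ n`, `e, e' ∣ N_{S∖q}` (the divisors of `q^n · N_{S∖q}` are the `q^j e` uniquely,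
`sum_divisors_prime_pow_mul`), and for them `χ'(q^j e) = χ'(e)` and `log d − log d' = log e − log e'`
(`pairFun_shift`). Hence `Σ_k face-sum(S, θ_k) = L (n+1) · face-sum(S.erase q, θ)`; every summand on
the left has real part `≥ 0` by hypothesis and `L (n+1) > 0`.

All statements are unconditional bookkeeping; no sign information enters (the sign of a face is the
crux, equivalent to RH).
-/

noncomputable section

-- the sub-problem path RiemannHypothesis/RiemannHypothesis duplicates a namespace (D-0017)
set_option linter.dupNamespace false

open scoped BigOperators ComplexConjugate Real
open Complex

namespace Summit.RiemannHypothesis.RiemannHypothesis.Theorems.WeilCombBohrFejer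

open Literature.NumberTheory.LFunctions

/-! ## Orthogonality of the `L`-th roots of unity -/

-- copied from …Theorems/WeilCombCombShapePositivityStubReduction.lean (private there)
/-- One-dimensional orthogonality of the `L`-th roots of unity: for an integer frequency `u` with
`|u| < L`, `Σ_{j<L} exp(2πi j u / L)` is `L` if `u = 0` and `0` otherwise. [folklore] -/
private theorem orth_one (L : ℕ) (u : ℤ) (hu : |u| < L) :
    ∑ j ∈ Finset.range L, Complex.exp (I * ((2 * π * (j : ℝ) / L * (u : ℝ) : ℝ) : ℂ)) =
      if u = 0 then (L : ℂ) else 0 := by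
  split_ifs with h
  · simp [h]
  · have hL0 : (L : ℂ) ≠ 0 := by
      have := abs_nonneg u
      exact_mod_cast (show 0 < L by omega).ne'
    have hI : (2 * π * I : ℂ) ≠ 0 := by simp [Real.pi_ne_zero]
    have hr : ∀ j ∈ Finset.range L,
        Complex.exp (I * ((2 * π * (j : ℝ) / L * (u : ℝ) : ℝ) : ℂ)) =
          Complex.exp (2 * π * I * u / L) ^ j := by
      intro j _
      rw [← Complex.exp_nat_mul]
      congr 1
      push_cast
      ring
    have hne : Complex.exp (2 * π * I * u / L) ≠ 1 := by
      intro h1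
      obtain ⟨n, hn⟩ := Complex.exp_eq_one_iff.mp h1
      rw [div_eq_iff hL0] at hn
      have h3 : (2 * π * I : ℂ) * u = (2 * π * I) * (n * L) := by linear_combination hn
      have hun : (u : ℂ) = n * L := mul_left_cancel₀ hI h3
      have hun' : u = n * L := by exact_mod_cast hun
      exact h (Int.eq_zero_of_abs_lt_dvd ⟨n, by rw [hun']; ring⟩ hu)
    rw [Finset.sum_congr rfl hr, geom_sum_eq hne, ← Complex.exp_nat_mul,
      show (L : ℂ) * (2 * π * I * u / L) = u * (2 * π * I) by
        rw [mul_comm, div_mul_cancel₀ _ hL0]; ring,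
      Complex.exp_int_mul_two_pi_mul_I]
    simp

/-- If `Σ_k f k = c · z` with every `Re (f k) ≥ 0` and `c > 0` a natural number, then `Re z ≥ 0`.
[folklore] -/
private theorem re_nonneg_of_sum_eq {ι : Type*} {G : Finset ι} {f : ι → ℂ} {c : ℕ} {z : ℂ}
    (hc : 0 < c) (h : ∑ k ∈ G, f k = (c : ℂ) * z) (hf : ∀ k ∈ G, 0 ≤ (f k).re) :
    0 ≤ z.re := by
  -- adapted from …StubReduction.lean (private there)
  have h1 : 0 ≤ (∑ k ∈ G, f k).re := by
    rw [Complex.re_sum]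
    exact Finset.sum_nonneg hf
  rw [h, ← Complex.ofReal_natCast, Complex.re_ofReal_mul] at h1
  exact (mul_nonneg_iff_of_pos_left (by positivity)).mp h1

/-! ## Divisors of the prime box -/

-- copied from …Theorems/WeilCombCombShapePositivityStubFejerBoxIdentity.lean
/-- The factorization of the prime box `N = ∏_{p∈S} p^n`: `v_q(N) = n` for `q ∈ S`, else `0`.
[folklore] -/
private theorem factorization_primeBox' {S : Finset ℕ} (hS : ∀ p ∈ S, p.Prime) (n q : ℕ) :
    (∏ p ∈ S, p ^ n).factorization q = if q ∈ S then n else 0 := by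
  rw [Nat.factorization_prod fun p hp => pow_ne_zero n (hS p hp).ne_zero, Finset.sum_apply']
  have h : ∀ p ∈ S, (p ^ n).factorization q = if p = q then n else 0 := fun p hp => by
    rw [(hS p hp).factorization_pow, Finsupp.single_apply]
  rw [Finset.sum_congr rfl h, Finset.sum_ite_eq']

/-- For `d ∣ ∏_{p∈S} p^n` and `q ∈ S`: `v_q(d) ≤ n`. [folklore] -/
private theorem factorization_le_of_mem_divisors_primeBox {S : Finset ℕ} (hS : ∀ p ∈ S, p.Prime)
    {q : ℕ} (hq : q ∈ S) (n : ℕ) {d : ℕ} (hd : d ∈ (∏ p ∈ S, p ^ n).divisors) :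
    d.factorization q ≤ n := by
  have hN0 : (∏ p ∈ S, p ^ n) ≠ 0 :=
    Finset.prod_ne_zero_iff.mpr fun p hp => pow_ne_zero n (hS p hp).ne_zero
  have h1 := (Nat.factorization_le_iff_dvd (Nat.pos_of_mem_divisors hd).ne' hN0).mpr
    (Nat.dvd_of_mem_divisors hd) q
  rwa [factorization_primeBox' hS n q, if_pos hq] at h1

/-- A prime `q` does not divide the box of `S.erase q`. [folklore] -/
private theorem not_dvd_primeBox_erase {S : Finset ℕ} (hS : ∀ p ∈ S, p.Prime) {q : ℕ}
    (hqP : q.Prime) (n : ℕ) : ¬ q ∣ ∏ p ∈ S.erase q, p ^ n := by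
  intro hdvd
  obtain ⟨p, hp, hqp⟩ := (hqP.prime.dvd_finsetProd_iff _).mp hdvd
  have hpq : q = p := (Nat.prime_dvd_prime_iff_eq hqP (hS p (Finset.mem_of_mem_erase hp))).mp
    (hqP.dvd_of_dvd_pow hqp)
  exact Finset.ne_of_mem_erase hp hpq.symm

-- adapted from Literature/NumberTheory/Sieve/QuadraticRootsPrimeModuliDFIDivisorSums.lean
/-- The divisors of `q^n a` (`q` prime, `q ∤ a`) are the `q^j e`, `j ≤ n`, `e ∣ a`, each once.
[folklore] -/
private theorem sum_divisors_prime_pow_mul {q a : ℕ} (hq : q.Prime) (hqa : ¬ q ∣ a) (n : ℕ)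
    (F : ℕ → ℂ) :
    ∑ d ∈ (q ^ n * a).divisors, F d =
      ∑ j ∈ Finset.range (n + 1), ∑ e ∈ a.divisors, F (q ^ j * e) := by
  have hcop : (q ^ n).Coprime a := Nat.Coprime.pow_left n (hq.coprime_iff_not_dvd.2 hqa)
  rw [Nat.divisors_mul, ← Finset.image_mul_product, Finset.sum_image hcop.mul_injOn_divisors,
    Finset.sum_product, Nat.divisors_prime_pow hq, Finset.sum_map]
  rfl

/-! ## The Bohr character with one coordinate updated / removed -/

/-- Splitting off the `q`-coordinate: `χ_{S, update θ q t}(d) = e^{i t v_q(d)} · χ_{S∖q, θ}(d)`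
(the update does not move `θ_p` for `p ≠ q`). [folklore] -/
private theorem bohrChar_update {S : Finset ℕ} {q : ℕ} (hq : q ∈ S) (θ : ℕ → ℝ) (t : ℝ) (d : ℕ) :
    Complex.exp (I * ((∑ p ∈ S, (Function.update θ q t) p * (d.factorization p : ℝ) : ℝ) : ℂ)) =
      Complex.exp (I * ((t * (d.factorization q : ℝ) : ℝ) : ℂ)) *
        Complex.exp (I * ((∑ p ∈ S.erase q, θ p * (d.factorization p : ℝ) : ℝ) : ℂ)) := by
  have hrest : ∑ p ∈ S.erase q, (Function.update θ q t) p * (d.factorization p : ℝ) =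
      ∑ p ∈ S.erase q, θ p * (d.factorization p : ℝ) :=
    Finset.sum_congr rfl fun p hp => by rw [Function.update_of_ne (Finset.ne_of_mem_erase hp)]
  rw [← Finset.add_sum_erase S _ hq, Function.update_self, hrest, Complex.ofReal_add, mul_add,
    Complex.exp_add]

/-- The twisted pair: `e^{ita} X · conj (e^{itb} Y) · Z = e^{it(a − b)} · (X conj Y Z)`. [folklore] -/
private theorem twist_pair (t : ℝ) (a b : ℕ) (X Y Z : ℂ) :
    Complex.exp (I * ((t * (a : ℝ) : ℝ) : ℂ)) * X *
        conj (Complex.exp (I * ((t * (b : ℝ) : ℝ) : ℂ)) * Y) * Z =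
      Complex.exp (I * ((t * (((a : ℤ) - (b : ℤ) : ℤ) : ℝ) : ℝ) : ℂ)) * (X * conj Y * Z) := by
  have h : Complex.exp (I * ((t * (((a : ℤ) - (b : ℤ) : ℤ) : ℝ) : ℝ) : ℂ)) =
      Complex.exp (I * ((t * (a : ℝ) : ℝ) : ℂ)) * conj (Complex.exp (I * ((t * (b : ℝ) : ℝ) : ℂ))) := by
    rw [← Complex.exp_conj, ← Complex.exp_add, map_mul, Complex.conj_I, Complex.conj_ofReal]
    congr 1
    push_cast
    ring
  rw [h, map_mul]
  ring

/-- Removing the `q`-part does not change the `S∖q`-character: `χ_{S∖q,θ}(q^j e) = χ_{S∖q,θ}(e)`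
(`v_p(q^j e) = v_p(e)` for `p ≠ q`). [folklore] -/
private theorem bohrChar_erase_pow_mul {S : Finset ℕ} {q : ℕ} (hqP : q.Prime) (θ : ℕ → ℝ) (j : ℕ)
    {e : ℕ} (he : e ≠ 0) :
    Complex.exp (I * ((∑ p ∈ S.erase q, θ p * ((q ^ j * e).factorization p : ℝ) : ℝ) : ℂ)) =
      Complex.exp (I * ((∑ p ∈ S.erase q, θ p * (e.factorization p : ℝ) : ℝ) : ℂ)) := by
  have hsum : ∑ p ∈ S.erase q, θ p * ((q ^ j * e).factorization p : ℝ) =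
      ∑ p ∈ S.erase q, θ p * (e.factorization p : ℝ) := by
    refine Finset.sum_congr rfl fun p hp => ?_
    rw [Nat.factorization_mul (pow_ne_zero j hqP.ne_zero) he, Finsupp.add_apply,
      hqP.factorization_pow, Finsupp.single_eq_of_ne (Finset.ne_of_mem_erase hp), zero_add]
  rw [hsum]

/-- Shift invariance of the reduced pair function: for `e, e' ≠ 0`,
`χ'(q^j e) conj χ'(q^j e') w(log(q^j e) − log(q^j e')) = χ'(e) conj χ'(e') w(log e − log e')`,
`χ' = χ_{S∖q,θ}`. [folklore] -/
private theorem pairFun_shift (w : ℝ → ℂ) {S : Finset ℕ} {q : ℕ} (hqP : q.Prime) (θ : ℕ → ℝ)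
    (j : ℕ) {e e' : ℕ} (he : e ≠ 0) (he' : e' ≠ 0) :
    Complex.exp (I * ((∑ p ∈ S.erase q, θ p * ((q ^ j * e).factorization p : ℝ) : ℝ) : ℂ)) *
        conj (Complex.exp (I * ((∑ p ∈ S.erase q, θ p *
          ((q ^ j * e').factorization p : ℝ) : ℝ) : ℂ))) *
        w (Real.log ((q ^ j * e : ℕ) : ℝ) - Real.log ((q ^ j * e' : ℕ) : ℝ)) =
      Complex.exp (I * ((∑ p ∈ S.erase q, θ p * (e.factorization p : ℝ) : ℝ) : ℂ)) *
        conj (Complex.exp (I * ((∑ p ∈ S.erase q, θ p * (e'.factorization p : ℝ) : ℝ) : ℂ))) *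
        w (Real.log (e : ℝ) - Real.log (e' : ℝ)) := by
  have hq0 : ((q : ℝ) ^ j) ≠ 0 := pow_ne_zero j (Nat.cast_ne_zero.mpr hqP.ne_zero)
  have hlog : Real.log ((q ^ j * e : ℕ) : ℝ) - Real.log ((q ^ j * e' : ℕ) : ℝ) =
      Real.log (e : ℝ) - Real.log (e' : ℝ) := by
    push_cast
    rw [Real.log_mul hq0 (Nat.cast_ne_zero.mpr he), Real.log_mul hq0 (Nat.cast_ne_zero.mpr he')]
    ring
  rw [bohrChar_erase_pow_mul hqP θ j he, bohrChar_erase_pow_mul hqP θ j he', hlog]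

/-! ## Grid averaging in the `q`-coordinate -/

/-- **Orthogonality step.** For any pair function `G` on the box `N = ∏_{p∈S} p^n` and `q ∈ S`:
`Σ_{k<n+1} Σ_{d,d' ∣ N} e^{2πi k (v_q(d) − v_q(d'))/(n+1)} G(d,d') = (n+1) Σ_{d,d' ∣ N, v_q(d) = v_q(d')} G(d,d')`
(both valuations lie in `[0, n]`). [folklore] -/
private theorem sum_grid_pairs (G : ℕ → ℕ → ℂ) {S : Finset ℕ} (hS : ∀ p ∈ S, p.Prime) {q : ℕ}
    (hq : q ∈ S) (n : ℕ) :
    ∑ k ∈ Finset.range (n + 1), ∑ d ∈ (∏ p ∈ S, p ^ n).divisors, ∑ d' ∈ (∏ p ∈ S, p ^ n).divisors,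
      Complex.exp (I * ((2 * π * (k : ℝ) / ((n + 1 : ℕ) : ℝ) *
        (((d.factorization q : ℤ) - (d'.factorization q : ℤ) : ℤ) : ℝ) : ℝ) : ℂ)) * G d d' =
    ((n + 1 : ℕ) : ℂ) * ∑ d ∈ (∏ p ∈ S, p ^ n).divisors, ∑ d' ∈ (∏ p ∈ S, p ^ n).divisors,
      if d.factorization q = d'.factorization q then G d d' else 0 := by
  rw [Finset.sum_comm, Finset.mul_sum]
  refine Finset.sum_congr rfl fun d hd => ?_
  rw [Finset.sum_comm, Finset.mul_sum]
  refine Finset.sum_congr rfl fun d' hd' => ?_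
  have h1 := factorization_le_of_mem_divisors_primeBox hS hq n hd
  have h2 := factorization_le_of_mem_divisors_primeBox hS hq n hd'
  have hu : |((d.factorization q : ℤ) - (d'.factorization q : ℤ))| < ((n + 1 : ℕ) : ℤ) := by
    rw [abs_lt]
    constructor <;> omega
  rw [← Finset.sum_mul, orth_one (n + 1) _ hu]
  by_cases hv : d.factorization q = d'.factorization q
  · simp [hv]
  · have hne : (d.factorization q : ℤ) - (d'.factorization q : ℤ) ≠ 0 := by omega
    simp [hv, hne]

/-- **Reindexing step.** The pairs of divisors of `N = q^n · N'`, `N' = ∏_{p ∈ S.erase q} p^n`, with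
equal `q`-valuation are the `(q^j e, q^j e')`, `j ≤ n`, `e, e' ∣ N'`; for a pair function invariant
under this shift the restricted pair sum is `(n+1) ·` the pair sum over the box of `S.erase q`.
[folklore] -/
private theorem sum_pairs_eq_val (G : ℕ → ℕ → ℂ) {S : Finset ℕ} (hS : ∀ p ∈ S, p.Prime) {q : ℕ}
    (hq : q ∈ S) (n : ℕ)
    (hG : ∀ j : ℕ, ∀ e ∈ (∏ p ∈ S.erase q, p ^ n).divisors,
      ∀ e' ∈ (∏ p ∈ S.erase q, p ^ n).divisors, G (q ^ j * e) (q ^ j * e') = G e e') :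
    ∑ d ∈ (∏ p ∈ S, p ^ n).divisors, ∑ d' ∈ (∏ p ∈ S, p ^ n).divisors,
      (if d.factorization q = d'.factorization q then G d d' else 0) =
    ((n + 1 : ℕ) : ℂ) * ∑ e ∈ (∏ p ∈ S.erase q, p ^ n).divisors,
      ∑ e' ∈ (∏ p ∈ S.erase q, p ^ n).divisors, G e e' := by
  have hqP : q.Prime := hS q hq
  have hqN' : ¬ q ∣ ∏ p ∈ S.erase q, p ^ n := not_dvd_primeBox_erase hS hqP n
  have hN : ∏ p ∈ S, p ^ n = q ^ n * ∏ p ∈ S.erase q, p ^ n :=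
    (Finset.mul_prod_erase S (fun p => p ^ n) hq).symm
  have hv : ∀ j, ∀ e ∈ (∏ p ∈ S.erase q, p ^ n).divisors, (q ^ j * e).factorization q = j := by
    intro j e he
    have he0 : e ≠ 0 := (Nat.pos_of_mem_divisors he).ne'
    have hqe : ¬ q ∣ e := fun h => hqN' (h.trans (Nat.dvd_of_mem_divisors he))
    rw [Nat.factorization_mul (pow_ne_zero j hqP.ne_zero) he0, Finsupp.add_apply,
      hqP.factorization_pow, Finsupp.single_eq_same, Nat.factorization_eq_zero_of_not_dvd hqe,
      add_zero]
  rw [hN, sum_divisors_prime_pow_mul hqP hqN' n,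
    show ((n + 1 : ℕ) : ℂ) * ∑ e ∈ (∏ p ∈ S.erase q, p ^ n).divisors,
        ∑ e' ∈ (∏ p ∈ S.erase q, p ^ n).divisors, G e e' =
      ∑ j ∈ Finset.range (n + 1), ∑ e ∈ (∏ p ∈ S.erase q, p ^ n).divisors,
        ∑ e' ∈ (∏ p ∈ S.erase q, p ^ n).divisors, G e e' by
      rw [Finset.sum_const, Finset.card_range, nsmul_eq_mul]]
  refine Finset.sum_congr rfl fun j hj => Finset.sum_congr rfl fun e he => ?_
  rw [sum_divisors_prime_pow_mul hqP hqN' n, Finset.sum_comm]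
  refine Finset.sum_congr rfl fun e' he' => ?_
  have hsummand : ∀ j' ∈ Finset.range (n + 1),
      (if (q ^ j * e).factorization q = (q ^ j' * e').factorization q
        then G (q ^ j * e) (q ^ j' * e') else 0) = if j = j' then G e e' else 0 := by
    intro j' _
    rw [hv j e he, hv j' e' he']
    split_ifs with hjj
    · rw [← hjj, hG j e he e' he']
    · rfl
  rw [Finset.sum_congr rfl hsummand, Finset.sum_ite_eq, if_pos hj]

/-! ## Heredity in `S` for an arbitrary kernel -/

/-- **Heredity in `S` (arbitrary kernel).** For any `w : ℝ → ℂ`, a finite set of primes `S`, `q ∈ S`,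
`n` and `θ`: if the Fejér face of `S` is `≥ 0` at `update θ q t₁` for every `t₁`, then the Fejér face
of `S.erase q` at `θ` is `≥ 0` (grid average in the `q`-coordinate). [folklore] -/
private theorem face_erase_kernel (w : ℝ → ℂ) {S : Finset ℕ} (hS : ∀ p ∈ S, p.Prime) {q : ℕ}
    (hq : q ∈ S) (n : ℕ) (θ : ℕ → ℝ)
    (h : ∀ t₁ : ℝ, 0 ≤ (∑ d ∈ (∏ p ∈ S, p ^ n).divisors, ∑ d' ∈ (∏ p ∈ S, p ^ n).divisors,
      Complex.exp (I * ((∑ p ∈ S, (Function.update θ q t₁) p * (d.factorization p : ℝ) : ℝ) : ℂ)) *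
        conj (Complex.exp (I * ((∑ p ∈ S, (Function.update θ q t₁) p *
          (d'.factorization p : ℝ) : ℝ) : ℂ))) *
        w (Real.log (d : ℝ) - Real.log (d' : ℝ))).re) :
    0 ≤ (∑ d ∈ (∏ p ∈ (S.erase q), p ^ n).divisors, ∑ d' ∈ (∏ p ∈ (S.erase q), p ^ n).divisors,
      Complex.exp (I * ((∑ p ∈ (S.erase q), θ p * (d.factorization p : ℝ) : ℝ) : ℂ)) *
        conj (Complex.exp (I * ((∑ p ∈ (S.erase q), θ p * (d'.factorization p : ℝ) : ℝ) : ℂ))) *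
        w (Real.log (d : ℝ) - Real.log (d' : ℝ))).re := by
  have hqP : q.Prime := hS q hq
  -- the reduced pair function `G(d, d') = χ'(d) conj χ'(d') w(log d − log d')`, `χ' = χ_{S∖q,θ}`
  set G : ℕ → ℕ → ℂ := fun d d' =>
    Complex.exp (I * ((∑ p ∈ S.erase q, θ p * (d.factorization p : ℝ) : ℝ) : ℂ)) *
      conj (Complex.exp (I * ((∑ p ∈ S.erase q, θ p * (d'.factorization p : ℝ) : ℝ) : ℂ))) *
      w (Real.log (d : ℝ) - Real.log (d' : ℝ)) with hG
  have hGshift : ∀ j : ℕ, ∀ e ∈ (∏ p ∈ S.erase q, p ^ n).divisors,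
      ∀ e' ∈ (∏ p ∈ S.erase q, p ^ n).divisors, G (q ^ j * e) (q ^ j * e') = G e e' :=
    fun j e he e' he' => pairFun_shift w hqP θ j (Nat.pos_of_mem_divisors he).ne'
      (Nat.pos_of_mem_divisors he').ne'
  -- the grid average of the twisted faces is `(n+1)(n+1) ·` the face of `S.erase q`
  have key : ∑ k ∈ Finset.range (n + 1),
      ∑ d ∈ (∏ p ∈ S, p ^ n).divisors, ∑ d' ∈ (∏ p ∈ S, p ^ n).divisors,
        Complex.exp (I * ((∑ p ∈ S, (Function.update θ q (2 * π * (k : ℝ) / ((n + 1 : ℕ) : ℝ))) p *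
          (d.factorization p : ℝ) : ℝ) : ℂ)) *
        conj (Complex.exp (I * ((∑ p ∈ S,
          (Function.update θ q (2 * π * (k : ℝ) / ((n + 1 : ℕ) : ℝ))) p *
            (d'.factorization p : ℝ) : ℝ) : ℂ))) *
        w (Real.log (d : ℝ) - Real.log (d' : ℝ)) =
      (((n + 1) * (n + 1) : ℕ) : ℂ) * ∑ e ∈ (∏ p ∈ S.erase q, p ^ n).divisors,
        ∑ e' ∈ (∏ p ∈ S.erase q, p ^ n).divisors, G e e' := by
    have hterm : ∀ k ∈ Finset.range (n + 1),
        ∑ d ∈ (∏ p ∈ S, p ^ n).divisors, ∑ d' ∈ (∏ p ∈ S, p ^ n).divisors,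
          Complex.exp (I * ((∑ p ∈ S,
            (Function.update θ q (2 * π * (k : ℝ) / ((n + 1 : ℕ) : ℝ))) p *
              (d.factorization p : ℝ) : ℝ) : ℂ)) *
          conj (Complex.exp (I * ((∑ p ∈ S,
            (Function.update θ q (2 * π * (k : ℝ) / ((n + 1 : ℕ) : ℝ))) p *
              (d'.factorization p : ℝ) : ℝ) : ℂ))) *
          w (Real.log (d : ℝ) - Real.log (d' : ℝ)) =
        ∑ d ∈ (∏ p ∈ S, p ^ n).divisors, ∑ d' ∈ (∏ p ∈ S, p ^ n).divisors,
          Complex.exp (I * ((2 * π * (k : ℝ) / ((n + 1 : ℕ) : ℝ) *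
            (((d.factorization q : ℤ) - (d'.factorization q : ℤ) : ℤ) : ℝ) : ℝ) : ℂ)) * G d d' := by
      intro k _
      refine Finset.sum_congr rfl fun d _ => Finset.sum_congr rfl fun d' _ => ?_
      rw [bohrChar_update hq, bohrChar_update hq, twist_pair]
    rw [Finset.sum_congr rfl hterm, sum_grid_pairs G hS hq n, sum_pairs_eq_val G hS hq n hGshift,
      ← mul_assoc, ← Nat.cast_mul]
  exact re_nonneg_of_sum_eq (Nat.mul_pos (Nat.succ_pos n) (Nat.succ_pos n)) key
    fun k _ => h (2 * π * (k : ℝ) / ((n + 1 : ℕ) : ℝ))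

/-! ## The registered stub -/

/-- **T5c `face_erase`** (registered stub of crux stmt-RiemannHypothesis-11229, plan
STUB-PLAN-stub_fejer, tier T5c "heredity in S"). For `ε > 0`, a finite set of primes `S`, `q ∈ S`,
`n` and `θ`: if the Fejér face of the comb symbol `w_ε(x) = W(τ_x(φ_ε ⋆ φ̃_ε))` on the box of `S` is
`≥ 0` at `update θ q t₁` for all `t₁`, then the Fejér face on the box of `S.erase q` at `θ` is `≥ 0`.
The kernel is irrelevant: this is `face_erase_kernel` at `w = w_ε`. [folklore] -/
theorem face_erase : ∀ ε : ℝ, 0 < ε → ∀ S : Finset ℕ, (∀ p ∈ S, p.Prime) → ∀ q ∈ S,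
    ∀ (n : ℕ) (θ : ℕ → ℝ), (∀ t₁ : ℝ, 0 ≤ (∑ d ∈ (∏ p ∈ S, p ^ n).divisors,
      ∑ d' ∈ (∏ p ∈ S, p ^ n).divisors,
      Complex.exp (I * ((∑ p ∈ S, (Function.update θ q t₁) p * (d.factorization p : ℝ) : ℝ) : ℂ)) *
        conj (Complex.exp (I * ((∑ p ∈ S, (Function.update θ q t₁) p *
          (d'.factorization p : ℝ) : ℝ) : ℂ))) *
        weilFunctional (weilTranslate (weilConv
          (fun t : ℝ => (ε : ℂ)⁻¹ * ((expNegInvGlue (1 - (t / ε) ^ 2) : ℝ) : ℂ))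
          (weilReflect (fun t : ℝ => (ε : ℂ)⁻¹ * ((expNegInvGlue (1 - (t / ε) ^ 2) : ℝ) : ℂ))))
          (Real.log (d : ℝ) - Real.log (d' : ℝ)))).re) →
    0 ≤ (∑ d ∈ (∏ p ∈ (S.erase q), p ^ n).divisors, ∑ d' ∈ (∏ p ∈ (S.erase q), p ^ n).divisors,
      Complex.exp (I * ((∑ p ∈ (S.erase q), θ p * (d.factorization p : ℝ) : ℝ) : ℂ)) *
        conj (Complex.exp (I * ((∑ p ∈ (S.erase q), θ p * (d'.factorization p : ℝ) : ℝ) : ℂ))) *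
        weilFunctional (weilTranslate (weilConv
          (fun t : ℝ => (ε : ℂ)⁻¹ * ((expNegInvGlue (1 - (t / ε) ^ 2) : ℝ) : ℂ))
          (weilReflect (fun t : ℝ => (ε : ℂ)⁻¹ * ((expNegInvGlue (1 - (t / ε) ^ 2) : ℝ) : ℂ))))
          (Real.log (d : ℝ) - Real.log (d' : ℝ)))).re := by
  intro ε _hε S hS q hq n θ h
  exact face_erase_kernel
    (w := fun x : ℝ => weilFunctional (weilTranslate (weilConv
      (fun t : ℝ => (ε : ℂ)⁻¹ * ((expNegInvGlue (1 - (t / ε) ^ 2) : ℝ) : ℂ))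
      (weilReflect (fun t : ℝ => (ε : ℂ)⁻¹ * ((expNegInvGlue (1 - (t / ε) ^ 2) : ℝ) : ℂ)))) x))
    hS hq n θ h

end Summit.RiemannHypothesis.RiemannHypothesis.Theorems.WeilCombBohrFejer

end
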